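import Summits.CriticalPhenomena.PercolationContinuityZ3.Theorems.PercNearOneGluingNoHeavyLowerTailSahiCombHereditary
import Literature.Combinatorics.Sahi2008.UniformSquareAllOrders

/-!
# The comb (tensor-Bernstein) hierarchy for Sahi's `E_k`, XXXIV: OR-MIXTURE CELLS ON THE CUBE — the generic three-slot cell at the COMB level
# (foundation of comb H-MIX(4) by lifting the law-level certificates)

Support file of the one-cut programme (crux `NoHeavyLowerTail`, stmt-CriticalPhenomena-4575; cell `prim-masterthm`, seat P3, gen 8;
`run/shared/lean/prim/prim-masterthm/prim-masterthm-p3/HIERARCHY.md` §15(d)).  Vocabulary: `SahiComb.CombPos`, `SahiCombDisjunct.orCoord`, `secAt` (sections at a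
coordinate), `SahiCombHereditary.CombHereditary` (gen 8), the law-level generic cell `SahiMixture.sahiE_three_mixEv_eq` (gen 6).

WHY.  By the BARRIER THEOREM (`SahiMixture.latticePositive_not_coin_stable`, this gen) no law-level class is an inductive invariant for the one-coordinate step; the
step must be done at the COMB level, where a CONSTANT-multiplier certificate `c_j = Σ λ·mono(atoms)·row + free` over hereditary rows lifts verbatim to `CombPos`
(atoms and rows are comb-positive polynomials in `p`; products, sums and elevation preserve comb positivity).  This file supplies the cube-level plumbing:
* `mixCoord e P Q = P ∪ ({e ∈ ω} ∩ Q)` — the cube form of `SahiMixture.mixEv` (off `e` it is `P`, on `e` it is `Q`, when `P ⊆ Q` ignore `e`); `mixCoord_inter`,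
  sections `secAt_true/false_mixCoord`, the block moment `ex_ind_mixCoord`: `μ_p(mixCoord) = (1 − p_e)·μ_p(P) + p_e·μ_p(Q)`; **`biInter_orCoord_eq_mixCoord`**: every member
  of the ∩-closed family of an OR-ed family `orCoord U e G` is `mixCoord e (U_K) (U_{K∖G})`.
* **`sahiE_three_mixCoord_eq`** — THE GENERIC THREE-SLOT CELL ON THE CUBE: for `P_j ⊆ Q_j` ignoring `e`,
  `E_3(μ_p; mixCoord e P_j Q_j) = (1−p_e)³E_3(μ_p;P) + p_e(1−p_e)²·mixC1 + p_e²(1−p_e)·mixC2 + p_e³E_3(μ_p;Q)` with `mixC1`, `mixC2` the SAME cubic moment polynomials as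
  in `sahiE_three_mixEv_eq` (so every law-level certificate for `C_1, C_2` applies pointwise in `p`).
* **`combPos_three_mixCoord_of_coeffs`** — if `E_3(μ_p;P)`, `mixC1`, `mixC2`, `E_3(μ_p;Q)` are comb-positive at multidegree `3` off `e`, the cell is comb-positive at
  multidegree `3` (`p_e^a(1−p_e)^b` are comb-positive, degrees add).
* `sahiE_ind_update_of_secAt` / **`CombHereditary.row_off`** — rows of a family ignoring `e` are comb-positive at multidegree `m` OFF `e` (what the certificates consume).
HONEST FRAMING: infrastructure only; no new positivity statement beyond `…SahiCombHereditary`. [this work]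
-/

noncomputable section

open scoped Classical

namespace Summit.CriticalPhenomena.PercolationContinuityZ3.Theorems

open Finset Function
open Literature.Combinatorics.Sahi2008
open Literature.Probability.Percolation.BHK2006 (ind_inter)
open Literature.Probability.Percolation.DecisionTree (ind ind_of_mem ind_of_not_mem ind_nonneg)
open SahiComb
open SahiCombDisjunct (orCoord)

variable {ι : Type} [Fintype ι]

namespace SahiCombMix

/-! ### The cube form of `mixEv` -/

/-- OR-ing the coordinate event into the `Q`-part: `mixCoord e P Q = P ∪ ({ω | e ∈ ω} ∩ Q)` (for `P ⊆ Q` ignoring `e`: `P` off `e`, `Q` on `e`). [this work] -/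
def mixCoord (e : ι) (P Q : Set (Set ι)) : Set (Set ι) := P ∪ ({ω : Set ι | e ∈ ω} ∩ Q)

omit [Fintype ι] in
/-- Membership in `mixCoord`. [this work] -/
theorem mem_mixCoord {e : ι} {P Q : Set (Set ι)} {ω : Set ι} : ω ∈ mixCoord e P Q ↔ ω ∈ P ∨ (e ∈ ω ∧ ω ∈ Q) := by
  simp [mixCoord]

omit [Fintype ι] in
/-- Intersections of `mixCoord`s of nested pairs are `mixCoord`s of the intersections. [this work] -/
theorem mixCoord_inter (e : ι) {P Q P' Q' : Set (Set ι)} (hPQ : P ⊆ Q) (hPQ' : P' ⊆ Q') :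
    mixCoord e P Q ∩ mixCoord e P' Q' = mixCoord e (P ∩ P') (Q ∩ Q') := by
  ext ω
  simp only [Set.mem_inter_iff, mem_mixCoord]
  constructor
  · rintro ⟨h1 | ⟨he, h1⟩, h2 | ⟨he', h2⟩⟩
    · exact Or.inl ⟨h1, h2⟩
    · exact Or.inr ⟨he', hPQ h1, h2⟩
    · exact Or.inr ⟨he, h1, hPQ' h2⟩
    · exact Or.inr ⟨he, h1, h2⟩
  · rintro (⟨h1, h2⟩ | ⟨he, h1, h2⟩)
    · exact ⟨Or.inl h1, Or.inl h2⟩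
    · exact ⟨Or.inr ⟨he, h1⟩, Or.inr ⟨he, h2⟩⟩

omit [Fintype ι] in
/-- Products of indicators of `mixCoord`s. [this work] -/
theorem ind_mixCoord_mul (e : ι) {P Q P' Q' : Set (Set ι)} (hPQ : P ⊆ Q) (hPQ' : P' ⊆ Q') :
    ind (mixCoord e P Q) * ind (mixCoord e P' Q') = ind (mixCoord e (P ∩ P') (Q ∩ Q')) := by
  rw [← mixCoord_inter e hPQ hPQ']
  funext ω
  exact (ind_inter _ _ ω).symm

section Sections

variable (e : ι) {P Q : Set (Set ι)} (hP : ∀ b, secAt e b P = P) (hQ : ∀ b, secAt e b Q = Q) (hPQ : P ⊆ Q)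
include hP hQ hPQ

omit [Fintype ι] in
/-- On `e`, `mixCoord e P Q` is `Q`. [this work] -/
theorem secAt_true_mixCoord : secAt e true (mixCoord e P Q) = Q := by
  unfold mixCoord
  rw [SahiCombDisjunct.secAt_union, secAt_inter, SahiCombDisjunct.secAt_true_coord, hP, hQ, Set.univ_inter]
  exact Set.union_eq_right.2 hPQ

omit [Fintype ι] hQ hPQ in
/-- Off `e`, `mixCoord e P Q` is `P`. [this work] -/
theorem secAt_false_mixCoord : secAt e false (mixCoord e P Q) = P := by
  unfold mixCoord
  rw [SahiCombDisjunct.secAt_union, secAt_inter, SahiCombDisjunct.secAt_false_coord, hP, Set.empty_inter, Set.union_empty]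

/-- **Block moment**: `μ_p(mixCoord e P Q) = (1 − p_e)·μ_p(P) + p_e·μ_p(Q)`. [this work] -/
theorem ex_ind_mixCoord (p : ι → unitInterval) :
    ex (bernoulliWeight p) (ind (mixCoord e P Q))
      = (1 - (p e : ℝ)) * ex (bernoulliWeight p) (ind P) + (p e : ℝ) * ex (bernoulliWeight p) (ind Q) := by
  rw [SahiCombDisjunct.ex_ind_of_secAt p e (secAt_true_mixCoord e hP hQ hPQ) (secAt_false_mixCoord e hP)]
  ring

end Sections

omit [Fintype ι] in
/-- **Members of the ∩-closed family of an OR-ed family are `mixCoord`s**: `⋂_{i∈K} (U_i ∪ [G i]{e∈ω}) = mixCoord e (⋂_{i∈K} U_i) (⋂_{i∈K, ¬G i} U_i)`. [this work] -/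
theorem biInter_orCoord_eq_mixCoord {n : ℕ} (U : Fin n → Set (Set ι)) (e : ι) (G : Fin n → Bool) (K : Finset (Fin n)) :
    (⋂ i ∈ K, orCoord U e G i) = mixCoord e (⋂ i ∈ K, U i) (⋂ i ∈ K.filter (fun i => G i = false), U i) := by
  ext ω
  simp only [Set.mem_iInter, mem_mixCoord, Finset.mem_filter, SahiCombDisjunct.orCoord]
  by_cases he : e ∈ ω
  · simp only [he, true_and]
    constructor
    · intro h
      by_cases hall : ∀ i ∈ K, ω ∈ U i
      · exact Or.inl hall
      · refine Or.inr fun i hi => ?_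
        have hi' := h i hi.1
        rw [hi.2] at hi'
        simpa using hi'
    · rintro (h | h) i hi
      · cases G i <;> simp [h i hi, he]
      · cases hG : G i
        · simpa using h i ⟨hi, hG⟩
        · simp [he]
  · constructor
    · intro h
      refine Or.inl fun i hi => ?_
      have hi' := h i hi
      cases hG : G i
      · rw [hG] at hi'; simpa using hi'
      · rw [hG] at hi'; simpa [he] using hi'
    · rintro (h | ⟨he', -⟩) i hi
      · cases G i <;> simp [h i hi]
      · exact absurd he' he

/-! ### Rows of a family ignoring `e` are comb-positive off `e` -/

omit [Fintype ι] in
/-- Products of indicators of events ignoring `e` ignore `e`. [folklore] -/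
theorem prod_ind_insert_of_secAt {m : ℕ} (V : Fin m → Set (Set ι)) (e : ι) (hV : ∀ (j : Fin m) (b : Bool), secAt e b (V j) = V j)
    (S : Finset (Fin m)) (ω : Set ι) : (∏ i ∈ S, ind (V i)) (insert e ω) = (∏ i ∈ S, ind (V i)) ω := by
  simp only [Finset.prod_apply]
  refine Finset.prod_congr rfl fun i _ => ?_
  rw [← hV i true]
  exact ind_secAt_insert e true (V i) ω

/-- **Rows of events ignoring `e` do not depend on `p_e`.** [this work] -/
theorem sahiE_ind_update_of_secAt {m : ℕ} (V : Fin m → Set (Set ι)) (e : ι) (hV : ∀ (j : Fin m) (b : Bool), secAt e b (V j) = V j)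
    (p : ι → unitInterval) (s : unitInterval) :
    sahiE (bernoulliWeight (update p e s)) m (fun j => ind (V j)) = sahiE (bernoulliWeight p) m (fun j => ind (V j)) :=
  sahiE_congr_of_moments _ _ m _ _ fun S _ =>
    SahiCombDisjunct.ex_update_of_ignores' e (fun ω => prod_ind_insert_of_secAt V e hV S ω) p s

omit [Fintype ι] in
/-- Members of the ∩-closed family of events ignoring `e` ignore `e`. [folklore] -/
theorem secAt_biInter {n : ℕ} (U : Fin n → Set (Set ι)) (e : ι) (hU : ∀ (j : Fin n) (b : Bool), secAt e b (U j) = U j)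
    (K : Finset (Fin n)) (b : Bool) : secAt e b (⋂ i ∈ K, U i) = ⋂ i ∈ K, U i := by
  induction K using Finset.induction_on with
  | empty =>
    ext ω; simp [mem_secAt]
  | insert a K haK ih =>
    rw [Finset.set_biInter_insert, secAt_inter, hU, ih]

/-- **A `CombHereditary` family ignoring `e`: every row of its ∩-closed family is comb-positive at multidegree `m` OFF `e`.** [this work] -/
theorem _root_.Summit.CriticalPhenomena.PercolationContinuityZ3.Theorems.SahiCombHereditary.CombHereditary.row_off {n : ℕ} {U : Fin n → Set (Set ι)}
    (hU : SahiCombHereditary.CombHereditary U) (e : ι) (hUe : ∀ (j : Fin n) (b : Bool), secAt e b (U j) = U j) (m : ℕ) (K : Fin m → Finset (Fin n)) :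
    CombPos (update (fun _ : ι => m) e 0) (fun p => sahiE (bernoulliWeight p) m (fun j => ind (⋂ i ∈ K j, U i))) :=
  (hU m K).of_ignores e fun p s => sahiE_ind_update_of_secAt (fun j => ⋂ i ∈ K j, U i) e (fun j b => secAt_biInter U e hUe (K j) b) p s

/-! ### The generic three-slot cell on the cube -/

section Three

variable (μ : Set ι → ℝ) (P Q : Fin 3 → Set (Set ι))

/-- The middle coefficient `C_1` of the generic three-slot OR-mixture cell (same polynomial as in `SahiMixture.sahiE_three_mixEv_eq`). [this work] -/
def mixC1 : ℝ := ex μ (ind (P 0)) * ex μ (ind (P 1)) * ex μ (ind (Q 2)) + ex μ (ind (P 0)) * ex μ (ind (P 2)) * ex μ (ind (Q 1)) + (-1) * ex μ (ind (P 0)) * ex μ (ind (P 1) * ind (P 2)) + (-1) * ex μ (ind (P 0)) * ex μ (ind (Q 1) * ind (Q 2)) + ex μ (ind (P 1)) * ex μ (ind (P 2)) * ex μ (ind (Q 0)) + (-1) * ex μ (ind (P 1)) * ex μ (ind (P 0) * ind (P 2)) + (-1) * ex μ (ind (P 1)) * ex μ (ind (Q 0) * ind (Q 2)) + (-1) * ex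 μ (ind (P 0) * ind (P 1)) * ex μ (ind (P 2)) + (-1) * ex μ (ind (P 0) * ind (P 1)) * ex μ (ind (Q 2)) + (-1) * ex μ (ind (P 2)) * ex μ (ind (Q 0) * ind (Q 1)) + (-1) * ex μ (ind (P 0) * ind (P 2)) * ex μ (ind (Q 1)) + (-1) * ex μ (ind (P 1) * ind (P 2)) * ex μ (ind (Q 0)) + 4 * ex μ (ind (P 0) * ind (P 1) * ind (P 2)) + 2 * ex μ (ind (Q 0) * ind (Q 1) * ind (Q 2))

/-- The middle coefficient `C_2` of the generic three-slot OR-mixture cell (same polynomial as in `SahiMixture.sahiE_three_mixEv_eq`). [this work] -/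
def mixC2 : ℝ := ex μ (ind (P 0)) * ex μ (ind (Q 1)) * ex μ (ind (Q 2)) + (-1) * ex μ (ind (P 0)) * ex μ (ind (Q 1) * ind (Q 2)) + ex μ (ind (P 1)) * ex μ (ind (Q 0)) * ex μ (ind (Q 2)) + (-1) * ex μ (ind (P 1)) * ex μ (ind (Q 0) * ind (Q 2)) + (-1) * ex μ (ind (P 0) * ind (P 1)) * ex μ (ind (Q 2)) + ex μ (ind (P 2)) * ex μ (ind (Q 0)) * ex μ (ind (Q 1)) + (-1) * ex μ (ind (P 2)) * ex μ (ind (Q 0) * ind (Q 1)) + (-1) * ex μ (ind (P 0) * ind (P 2)) * ex μ (ind (Q 1)) + (-1) * ex μ (ind (P 1) * ind (P 2)) * ex μ (ind (Q 0)) + 2 * ex μ (ind (P 0) * ind (P 1) * ind (P 2)) + (-1) * ex μ (ind (Q 0)) * ex μ (ind (Q 1) * ind (Q 2)) + (-1) * ex μ (ind (Q 1)) * ex μ (ind (Q 0) * ind (Q 2)) + (-1) * ex μ (ind (Q 0) * ind (Q 1)) * ex μ (ind (Q 2)) + 4 * ex μ (ind (Q 0) * ind (Q 1) * ind (Q 2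))

end Three

section Cell

variable (e : ι) (P Q : Fin 3 → Set (Set ι)) (hP : ∀ (j : Fin 3) (b : Bool), secAt e b (P j) = P j)
  (hQ : ∀ (j : Fin 3) (b : Bool), secAt e b (Q j) = Q j) (hPQ : ∀ j, P j ⊆ Q j)
include hP hQ hPQ

/-- **THE GENERIC THREE-SLOT CELL ON THE CUBE** in Bernstein form along `p_e`. [this work] -/
theorem sahiE_three_mixCoord_eq (p : ι → unitInterval) :
    sahiE (bernoulliWeight p) 3 (fun j => ind (mixCoord e (P j) (Q j)))
      = (1 - (p e : ℝ)) ^ 3 * sahiE (bernoulliWeight p) 3 (fun j => ind (P j))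
        + (p e : ℝ) * (1 - (p e : ℝ)) ^ 2 * mixC1 (bernoulliWeight p) P Q
        + (p e : ℝ) ^ 2 * (1 - (p e : ℝ)) * mixC2 (bernoulliWeight p) P Q
        + (p e : ℝ) ^ 3 * sahiE (bernoulliWeight p) 3 (fun j => ind (Q j)) := by
  have hPi : ∀ (i j : Fin 3) (b : Bool), secAt e b (P i ∩ P j) = P i ∩ P j := fun i j b => by rw [secAt_inter, hP, hP]
  have hQi : ∀ (i j : Fin 3) (b : Bool), secAt e b (Q i ∩ Q j) = Q i ∩ Q j := fun i j b => by rw [secAt_inter, hQ, hQ]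
  have hPii : ∀ b : Bool, secAt e b (P 0 ∩ P 1 ∩ P 2) = P 0 ∩ P 1 ∩ P 2 := fun b => by rw [secAt_inter, hPi, hP]
  have hQii : ∀ b : Bool, secAt e b (Q 0 ∩ Q 1 ∩ Q 2) = Q 0 ∩ Q 1 ∩ Q 2 := fun b => by rw [secAt_inter, hQi, hQ]
  have sPQ : ∀ i j : Fin 3, P i ∩ P j ⊆ Q i ∩ Q j := fun i j => Set.inter_subset_inter (hPQ i) (hPQ j)
  -- block moments of the mixed slots
  have m1 : ∀ j : Fin 3, ex (bernoulliWeight p) (ind (mixCoord e (P j) (Q j)))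
      = (1 - (p e : ℝ)) * ex (bernoulliWeight p) (ind (P j)) + (p e : ℝ) * ex (bernoulliWeight p) (ind (Q j)) :=
    fun j => ex_ind_mixCoord e (hP j) (hQ j) (hPQ j) p
  have m2 : ∀ i j : Fin 3, ex (bernoulliWeight p) (ind (mixCoord e (P i) (Q i)) * ind (mixCoord e (P j) (Q j)))
      = (1 - (p e : ℝ)) * ex (bernoulliWeight p) (ind (P i) * ind (P j)) + (p e : ℝ) * ex (bernoulliWeight p) (ind (Q i) * ind (Q j)) := by
    intro i j
    rw [ind_mixCoord_mul e (hPQ i) (hPQ j), ex_ind_mixCoord e (hPi i j) (hQi i j) (sPQ i j) p]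
    congr 2 <;> (congr 1; funext ω; exact ind_inter _ _ ω)
  have m3 : ex (bernoulliWeight p) (ind (mixCoord e (P 0) (Q 0)) * ind (mixCoord e (P 1) (Q 1)) * ind (mixCoord e (P 2) (Q 2)))
      = (1 - (p e : ℝ)) * ex (bernoulliWeight p) (ind (P 0) * ind (P 1) * ind (P 2))
        + (p e : ℝ) * ex (bernoulliWeight p) (ind (Q 0) * ind (Q 1) * ind (Q 2)) := by
    rw [ind_mixCoord_mul e (hPQ 0) (hPQ 1), ind_mixCoord_mul e (sPQ 0 1) (hPQ 2),
      ex_ind_mixCoord e hPii hQii (Set.inter_subset_inter (sPQ 0 1) (hPQ 2)) p]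
    congr 2 <;> (congr 1; funext ω; rw [Pi.mul_apply, Pi.mul_apply, ind_inter, ind_inter])
  rw [sahiE_three_apply, sahiE_three_apply, sahiE_three_apply]
  simp only [m1, m2, m3, mixC1, mixC2]
  ring

/-- **Comb positivity of the three-slot cell from its coefficients**: if `E_3(μ_p;P)`, `mixC1`, `mixC2`, `E_3(μ_p;Q)` are comb-positive at multidegree `3` off `e`,
then `p ↦ E_3(μ_p; mixCoord e P_j Q_j)` is comb-positive at multidegree `3`. [this work] -/
theorem combPos_three_mixCoord_of_coeffs
    (h0 : CombPos (update (fun _ : ι => 3) e 0) (fun p => sahiE (bernoulliWeight p) 3 (fun j => ind (P j))))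
    (h1 : CombPos (update (fun _ : ι => 3) e 0) (fun p => mixC1 (bernoulliWeight p) P Q))
    (h2 : CombPos (update (fun _ : ι => 3) e 0) (fun p => mixC2 (bernoulliWeight p) P Q))
    (h3 : CombPos (update (fun _ : ι => 3) e 0) (fun p => sahiE (bernoulliWeight p) 3 (fun j => ind (Q j)))) :
    CombPos (fun _ : ι => 3) (fun p => sahiE (bernoulliWeight p) 3 (fun j => ind (mixCoord e (P j) (Q j)))) := by
  have d := SahiCombDisjunct.deg_le_three e (le_refl 3) (le_refl 3)
  have t0 := (SahiCombDisjunct.combPos_coord_pow e 0 3).mul_of_le h0 d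
  have t1 := (SahiCombDisjunct.combPos_coord_pow e 1 2).mul_of_le h1 d
  have t2 := (SahiCombDisjunct.combPos_coord_pow e 2 1).mul_of_le h2 d
  have t3 := (SahiCombDisjunct.combPos_coord_pow e 3 0).mul_of_le h3 d
  refine (((t0.add t1).add t2).add t3).congr fun p => ?_
  rw [sahiE_three_mixCoord_eq e P Q hP hQ hPQ p]
  ring

end Cell

end SahiCombMix

end Summit.CriticalPhenomena.PercolationContinuityZ3.Theorems

end
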